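import Summits.QuantumFields.YangMills.Theses.RandomConstraintAnnealing
import Summits.QuantumFields.YangMills.Theorems.RandomConstraintAnnealingEdwardsSokal
import Literature.MathematicalPhysics.QuantumFieldTheory.QCDTorusTranslation
import HarnessLib

/-!
# `RandomConstraintAnnealing.TotalCovarianceGlue` (item stmt-QuantumFields-8720)

`QuenchedTubeGapInMean → ThresholdDecorrelation → TubeGapLatticeLeg` by the LAW OF TOTAL COVARIANCE under the
Edwards–Sokal disintegration (`edwardsSokalDisintegration_proof`, item 8719): with `E_c = Haar[· | tube c]` and the
threshold law `ρ = ρ'/ρ'(univ)`,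
`Cov_{Wilson}(a, b) = ∫ Cov_{E_c}(a, b) dρ + (∫ E_c a · E_c b dρ − ∫ E_c a dρ · ∫ E_c b dρ)`,
the unshifted mean `∫ B∘torusLift dμ` in `latticeConnectedCorr` being the shifted one by translation invariance.
The technical points the card names are discharged: `T2Space`/`SecondCountableTopology G` from the closed embedding
`r.ρ`; measurability of `c ↦ E_c Φ` (parametric integral of the jointly measurable tube indicator); `|E_c Φ| ≤ K`
including the Haar-null tubes (`cond = 0`); `ρ` is a probability measure (`0 < ρ'(univ) < ∞`); `Cⁱ ≥ 0` read off
`n = 0`.  Bookkeeping only: the two cruxes and the UV/OS leg stay open; the YM mass gap is NOT proved.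
-/

set_option autoImplicit false

namespace Summit.QuantumFields.YangMills.Theorems.RandomConstraintAnnealing

open MeasureTheory ProbabilityTheory
open Literature.MathematicalPhysics.QuantumFieldTheory
open Literature.MathematicalPhysics.QuantumLattice (LGConfig torusLift configShift)

section CondMean

variable {Ω ι : Type*} [MeasurableSpace Ω] [Fintype ι] (μ : Measure Ω) [IsProbabilityMeasure μ]
  (P : Ω → ι → ℝ)

/-- The tube-conditional mean `c ↦ ∫ Φ dμ[· | tube c]` of a bounded measurable `Φ` is measurable in the thresholds. -/
theorem measurable_condMean (hPm : ∀ p, Measurable (fun U => P U p)) (Φ : Ω → ℝ) (hΦm : Measurable Φ) :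
    Measurable fun c : ι → ℝ => ∫ U, Φ U ∂(ProbabilityTheory.cond μ {U | ∀ p, c p < P U p}) := by
  have h1 : (fun c : ι → ℝ => ∫ U, Φ U ∂(ProbabilityTheory.cond μ {U | ∀ p, c p < P U p})) =
      fun c => ((μ {U | ∀ p, c p < P U p})⁻¹).toReal *
        ∫ U, Set.indicator {z : (ι → ℝ) × Ω | ∀ p, z.1 p < P z.2 p} (fun z => Φ z.2) (c, U) ∂μ := by
    funext c
    rw [ProbabilityTheory.cond, integral_smul_measure, smul_eq_mul, ← integral_indicator (measurableSet_tube P hPm c)]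
    congr 1
  rw [h1]
  have h2 : Measurable fun c : ι → ℝ => μ {U | ∀ p, c p < P U p} := by
    have e : (fun c : ι → ℝ => μ {U | ∀ p, c p < P U p}) =
        fun c => μ (Prod.mk c ⁻¹' {z : (ι → ℝ) × Ω | ∀ p, z.1 p < P z.2 p}) := rfl
    rw [e]
    exact measurable_measure_prodMk_left (measurableSet_jointTube P hPm)
  refine (h2.inv.ennreal_toReal).mul ?_
  have h3 : StronglyMeasurable (Set.indicator {z : (ι → ℝ) × Ω | ∀ p, z.1 p < P z.2 p} (fun z => Φ z.2)) :=
    ((hΦm.comp measurable_snd).indicator (measurableSet_jointTube P hPm)).stronglyMeasurable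
  exact (h3.integral_prod_right' (ν := μ)).measurable

omit [Fintype ι] in
/-- `|∫ Φ dμ[· | s]| ≤ K` when `|Φ| ≤ K` (the conditional measure of a null set is `0`). -/
theorem abs_condMean_le (s : Set Ω) (Φ : Ω → ℝ) {K : ℝ} (hK : ∀ U, |Φ U| ≤ K) (hK0 : 0 ≤ K) :
    |∫ U, Φ U ∂(ProbabilityTheory.cond μ s)| ≤ K := by
  by_cases hs : μ s = 0
  · rw [ProbabilityTheory.cond_eq_zero_of_meas_eq_zero hs, integral_zero_measure, abs_zero]; exact hK0
  · haveI := ProbabilityTheory.cond_isProbabilityMeasure (μ := μ) hs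
    calc |∫ U, Φ U ∂(ProbabilityTheory.cond μ s)| ≤ ∫ U, |Φ U| ∂(ProbabilityTheory.cond μ s) :=
          abs_integral_le_integral_abs
      _ ≤ ∫ _U, K ∂(ProbabilityTheory.cond μ s) := by
          by_cases hi : Integrable (fun U => |Φ U|) (ProbabilityTheory.cond μ s)
          · exact integral_mono hi (integrable_const K) fun U => hK U
          · rw [integral_undef hi]; simp [hK0]
      _ = K := by simp

end CondMean

/-- **Route item `RandomConstraintAnnealing.TotalCovarianceGlue` (stmt-QuantumFields-8720):**
`QuenchedTubeGapInMean → ThresholdDecorrelation → TubeGapLatticeLeg` by the law of total covariance under the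
Edwards–Sokal disintegration. -/
theorem totalCovarianceGlue_proof :
    Summit.QuantumFields.YangMills.Theses.RandomConstraintAnnealing.TotalCovarianceGlue := by
  intro hQ hT G _ _ _ _ hG
  letI : MeasurableSpace G := borel G
  haveI : BorelSpace G := ⟨rfl⟩
  intro r
  obtain ⟨β₁, m₁, S₁, hm₁, h₁⟩ := hQ G hG r
  obtain ⟨β₂, m₂, S₂, hm₂, h₂⟩ := hT G hG r
  refine ⟨max (max β₁ β₂) 1, fun β => min (m₁ β) (m₂ β), fun β => max (S₁ β) (S₂ β),
    fun β hβ => lt_min (hm₁ β ((le_max_left _ _).trans ((le_max_left _ _).trans hβ)))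
      (hm₂ β ((le_max_right _ _).trans ((le_max_left _ _).trans hβ))), fun A B => ?_⟩
  obtain ⟨C₁, hC₁⟩ := h₁ A B
  obtain ⟨C₂, hC₂⟩ := h₂ A B
  refine ⟨C₁ + C₂, fun β hβ S hS n hn => ?_⟩
  have hβ₁ : β₁ ≤ β := (le_max_left _ _).trans ((le_max_left _ _).trans hβ)
  have hβ₂ : β₂ ≤ β := (le_max_right _ _).trans ((le_max_left _ _).trans hβ)
  have hβpos : 0 < β := lt_of_lt_of_le one_pos ((le_max_right _ _).trans hβ)
  have hS₁ : S₁ β ≤ S := (le_max_left _ _).trans hS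
  have hS₂ : S₂ β ≤ S := (le_max_right _ _).trans hS
  -- instances from the closed embedding `r.ρ`
  haveI : SecondCountableTopology G :=
    (r.continuous.isClosedEmbedding r.injective).isEmbedding.secondCountableTopology
  haveI : T2Space G := (r.continuous.isClosedEmbedding r.injective).isEmbedding.t2Space
  -- vocabulary (the `let`-objects of the two cruxes at the torus of side `2S+1`)
  set T : ℕ := 2 * S + 1 with hT
  set P : GaugeConfig 4 T G → Plaquette 4 T → ℝ :=
    fun U p => (r.ρ (plaquetteHolonomy U p.1 p.2.1.1 p.2.1.2)).trace.re with hP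
  set haar : Measure (GaugeConfig 4 T G) := Measure.pi fun _ => haarProbability G with hhaar
  set tube : (Plaquette 4 T → ℝ) → Set (GaugeConfig 4 T G) := fun c => {U | ∀ p, c p < P U p} with htube
  set μc : (Plaquette 4 T → ℝ) → Measure (GaugeConfig 4 T G) := fun c => ProbabilityTheory.cond haar (tube c)
    with hμc
  set ρ' : Measure (Plaquette 4 T → ℝ) := (Measure.pi fun _ : Plaquette 4 T => (volume : Measure ℝ)).withDensity
    fun c => ENNReal.ofReal (∏ p, β * Real.exp (β * c p)) * haar (tube c) with hρ'
  set ρm : Measure (Plaquette 4 T → ℝ) := (ρ' Set.univ)⁻¹ • ρ' with hρm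
  set a : GaugeConfig 4 T G → ℝ := fun U => A.F (torusLift T U) with ha
  set b : GaugeConfig 4 T G → ℝ := fun U => B.F (configShift (-Pi.single 0 (n : ℤ)) (torusLift T U)) with hb
  set μW : Measure (GaugeConfig 4 T G) := wilsonMeasure (d := 4) (L := T) r.ρ β with hμW
  -- the two inputs at `(β, S, n)` and at `(β, S, 0)`, restated
  have e₁ := hC₁ β hβ₁ S hS₁ n hn
  have e₂ := hC₂ β hβ₂ S hS₂ n hn
  have e₁0 := hC₁ β hβ₁ S hS₁ 0 (Nat.zero_le _)
  have e₂0 := hC₂ β hβ₂ S hS₂ 0 (Nat.zero_le _)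
  have E₁ : ∫ c, |(∫ U, a U * b U ∂μc c) - (∫ U, a U ∂μc c) * (∫ U, b U ∂μc c)| ∂ρm ≤
      C₁ * Real.exp (-(m₁ β * n)) := e₁
  have E₂ : |(∫ c, (∫ U, a U ∂μc c) * (∫ U, b U ∂μc c) ∂ρm) -
      (∫ c, (∫ U, a U ∂μc c) ∂ρm) * (∫ c, (∫ U, b U ∂μc c) ∂ρm)| ≤ C₂ * Real.exp (-(m₂ β * n)) := e₂
  have hC₁ : 0 ≤ C₁ := by
    have h := e₁0
    simp only [Nat.cast_zero, mul_zero, neg_zero, Real.exp_zero, mul_one] at h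
    exact le_trans (integral_nonneg fun c => abs_nonneg _) h
  have hC₂ : 0 ≤ C₂ := by
    have h := e₂0
    simp only [Nat.cast_zero, mul_zero, neg_zero, Real.exp_zero, mul_one] at h
    exact le_trans (abs_nonneg _) h
  -- the observables: measurable and bounded
  haveI : IsProbabilityMeasure haar := by rw [hhaar]; infer_instance
  have ham : Measurable a := A.measurable.comp (measurable_torusLift (d := 4) (G := G) T)
  have hbm : Measurable b := by
    refine B.measurable.comp ?_
    refine Measurable.comp ?_ (measurable_torusLift (d := 4) (G := G) T)
    exact MeasurableEquiv.measurable _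
  obtain ⟨Ka, hKa⟩ := A.bounded
  obtain ⟨Kb, hKb⟩ := B.bounded
  have hKa0 : 0 ≤ Ka := (abs_nonneg _).trans (hKa (torusLift T (fun _ => 1)))
  have hKb0 : 0 ≤ Kb := (abs_nonneg _).trans (hKb (torusLift T (fun _ => 1)))
  have hab : ∀ U, |a U| ≤ Ka := fun U => hKa _
  have hbb : ∀ U, |b U| ≤ Kb := fun U => hKb _
  have habm : Measurable (fun U => a U * b U) := ham.mul hbm
  have habb : ∀ U, |a U * b U| ≤ Ka * Kb := fun U => by
    rw [abs_mul]; exact mul_le_mul (hab U) (hbb U) (abs_nonneg _) hKa0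
  -- the Edwards–Sokal disintegration for `a·b`, `a`, `b`
  have hES := edwardsSokalDisintegration_proof 4 T r.N G r.ρ r.continuous β hβpos
  have hpos : 0 < ρ' Set.univ ∧ ρ' Set.univ < ⊤ := (hES a ham ⟨Ka, hab⟩).1
  have Iab : ∫ U, a U * b U ∂μW = ∫ c, (∫ U, a U * b U ∂μc c) ∂ρm := (hES _ habm ⟨Ka * Kb, habb⟩).2
  have Ia : ∫ U, a U ∂μW = ∫ c, (∫ U, a U ∂μc c) ∂ρm := (hES a ham ⟨Ka, hab⟩).2
  have Ib : ∫ U, b U ∂μW = ∫ c, (∫ U, b U ∂μc c) ∂ρm := (hES b hbm ⟨Kb, hbb⟩).2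
  haveI : IsProbabilityMeasure ρm := ⟨by
    rw [hρm, Measure.smul_apply, smul_eq_mul, ENNReal.inv_mul_cancel hpos.1.ne' hpos.2.ne]⟩
  -- the tube-conditional means are bounded measurable, hence ρ-integrable
  have hPm : ∀ p, Measurable fun U => P U p := fun p => (continuous_plaqLevel (d := 4) (L := T) r.ρ r.continuous p).measurable
  have hint : ∀ (Φ : GaugeConfig 4 T G → ℝ) (K : ℝ), Measurable Φ → (∀ U, |Φ U| ≤ K) → 0 ≤ K →
      Measurable (fun c => ∫ U, Φ U ∂μc c) ∧ (∀ c, |∫ U, Φ U ∂μc c| ≤ K) := fun Φ K hΦm hΦb hK0 =>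
    ⟨measurable_condMean haar P hPm Φ hΦm, fun c => abs_condMean_le haar (tube c) Φ hΦb hK0⟩
  have hintg : ∀ (g : (Plaquette 4 T → ℝ) → ℝ) (K : ℝ), Measurable g → (∀ c, |g c| ≤ K) → Integrable g ρm :=
    fun g K hgm hgb => Integrable.mono' (integrable_const K) hgm.aestronglyMeasurable
      (Filter.Eventually.of_forall fun c => by rw [Real.norm_eq_abs]; exact hgb c)
  obtain ⟨mEa, bEa⟩ := hint a Ka ham hab hKa0
  obtain ⟨mEb, bEb⟩ := hint b Kb hbm hbb hKb0
  obtain ⟨mEab, bEab⟩ := hint _ (Ka * Kb) habm habb (mul_nonneg hKa0 hKb0)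
  have iEab : Integrable (fun c => ∫ U, a U * b U ∂μc c) ρm := hintg _ _ mEab bEab
  have iEaEb : Integrable (fun c => (∫ U, a U ∂μc c) * (∫ U, b U ∂μc c)) ρm :=
    hintg _ (Ka * Kb) (mEa.mul mEb) fun c => by
      rw [abs_mul]; exact mul_le_mul (bEa c) (bEb c) (abs_nonneg _) hKa0
  -- translation invariance: the unshifted mean of `B` equals the shifted one
  have htrans : ∫ U, B.F (torusLift T U) ∂μW = ∫ U, b U ∂μW := by
    have h := wilsonExpectation_comp_torusConfigShift (d := 4) (L := T) r.ρ β
      (Literature.Probability.LatticeModels.Torus.proj T (-Pi.single 0 (n : ℤ))) (B.F ∘ torusLift T)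
    have e : (B.F ∘ torusLift T) ∘ (TorusTranslation.torusConfigShift
        (Literature.Probability.LatticeModels.Torus.proj T (-Pi.single 0 (n : ℤ)))) = b := by
      funext U
      simp only [hb, Function.comp_apply, configShift_torusLift]
    rw [e] at h
    exact h.symm
  -- LAW OF TOTAL COVARIANCE
  have hcov : Literature.MathematicalPhysics.QuantumFieldTheory.latticeConnectedCorr r.ρ β T A.F B.F n =
      (∫ c, ((∫ U, a U * b U ∂μc c) - (∫ U, a U ∂μc c) * (∫ U, b U ∂μc c)) ∂ρm) +
        ((∫ c, (∫ U, a U ∂μc c) * (∫ U, b U ∂μc c) ∂ρm) -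
          (∫ c, (∫ U, a U ∂μc c) ∂ρm) * (∫ c, (∫ U, b U ∂μc c) ∂ρm)) := by
    change (∫ U, a U * b U ∂μW) - (∫ U, a U ∂μW) * (∫ U, B.F (torusLift T U) ∂μW) = _
    rw [htrans, Iab, Ia, Ib, integral_sub iEab iEaEb]
    ring
  have hm₁ : Real.exp (-(m₁ β * n)) ≤ Real.exp (-(min (m₁ β) (m₂ β) * n)) :=
    Real.exp_le_exp.2 (by nlinarith [min_le_left (m₁ β) (m₂ β), (Nat.cast_nonneg n : (0:ℝ) ≤ n)])
  have hm₂ : Real.exp (-(m₂ β * n)) ≤ Real.exp (-(min (m₁ β) (m₂ β) * n)) :=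
    Real.exp_le_exp.2 (by nlinarith [min_le_right (m₁ β) (m₂ β), (Nat.cast_nonneg n : (0:ℝ) ≤ n)])
  rw [hcov]
  calc |(∫ c, ((∫ U, a U * b U ∂μc c) - (∫ U, a U ∂μc c) * (∫ U, b U ∂μc c)) ∂ρm) +
        ((∫ c, (∫ U, a U ∂μc c) * (∫ U, b U ∂μc c) ∂ρm) -
          (∫ c, (∫ U, a U ∂μc c) ∂ρm) * (∫ c, (∫ U, b U ∂μc c) ∂ρm))|
      ≤ |∫ c, ((∫ U, a U * b U ∂μc c) - (∫ U, a U ∂μc c) * (∫ U, b U ∂μc c)) ∂ρm| +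
        |(∫ c, (∫ U, a U ∂μc c) * (∫ U, b U ∂μc c) ∂ρm) -
          (∫ c, (∫ U, a U ∂μc c) ∂ρm) * (∫ c, (∫ U, b U ∂μc c) ∂ρm)| := abs_add_le _ _
    _ ≤ C₁ * Real.exp (-(m₁ β * n)) + C₂ * Real.exp (-(m₂ β * n)) :=
        add_le_add (abs_integral_le_integral_abs.trans E₁) E₂
    _ ≤ C₁ * Real.exp (-(min (m₁ β) (m₂ β) * n)) + C₂ * Real.exp (-(min (m₁ β) (m₂ β) * n)) :=
        add_le_add (mul_le_mul_of_nonneg_left hm₁ hC₁) (mul_le_mul_of_nonneg_left hm₂ hC₂)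
    _ = (C₁ + C₂) * Real.exp (-(min (m₁ β) (m₂ β) * n)) := by ring

end Summit.QuantumFields.YangMills.Theorems.RandomConstraintAnnealing
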